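import Literature.NumberTheory.GaloisRepresentations.ContinuousH1
import HarnessLib

/-!
# Continuous `H¹` along a coordinate system of the coefficient module:
# `H¹(G, X₁) ≃ H¹(G, X)^ι` when `X₁ ≃ X^ι` equivariantly (additivity of `H¹` in the coefficients,
# across two coefficient rings)

Generic glue (namespace `Literature.NumberTheory.GaloisRepresentations`) on top of
`ContinuousH1.lean` (explicit crossed homomorphisms for Mathlib's `continuousCohomology 1`).

**Setting.** `G` a topological group; `X : TopRep Λ G` and `X₁ : TopRep Λ₁ G` topological
representations over two (unrelated) coefficient rings `Λ`, `Λ₁`; a finite index type `ι`; and a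
**coordinate system**: an additive, bicontinuous, `G`-equivariant identification
`Θ : X₁ ≃+ (ι → X)` (`Θ (g • m) i = g • Θ m i`). The model case (file
`Literature/NumberTheory/EllipticCurves/BigRepModuleCoeffExtension.lean`): `Λ = 𝒪⟦T⟧`,
`Λ₁ = 𝒪₁⟦T⟧` for `𝒪₁` free of finite rank over `𝒪` with basis `(b_i)_{i ∈ ι}`, `X = T ⊗ Λ_𝒪^*`,
`X₁ = (T ⊗_𝒪 𝒪₁) ⊗ Λ_{𝒪₁}^*`, `Θ` = coordinates with respect to `b`.

**What is proved** (all elementary; Serre, *Galois Cohomology* I §2.2: cohomology of a finite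
product of `G`-modules is the product of the cohomologies, computed on inhomogeneous cochains):

* `cocycleCoord Θ … φ i` — the `i`-th coordinate crossed homomorphism `g ↦ Θ (φ g) i` of a continuous
  crossed homomorphism `φ : G → X₁`; `cocyclesOfCoords` — the inverse assembly; they are mutually
  inverse (`cocycleCoord_cocyclesOfCoords`, `cocyclesOfCoords_cocycleCoord`).
* `isPrincipal_iff_forall_cocycleCoord` — `φ` is principal iff every coordinate is principal.
* `cohomologyCoord Θ … x i ∈ H¹(G, X)` — the coordinates of a class `x ∈ H¹(G, X₁)`
  (`cohomologyCoord_oneCocycleClass`: `[φ] ↦ ([Θ_i ∘ φ])_i`), additive, and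
  **`cohomologyCoordEquiv : H¹(G, X₁) ≃+ (ι → H¹(G, X))`** (bijective: injective by the principal
  criterion, surjective by assembling representatives).
* `cohomologyCoord_smul_of_matrix` — if a scalar `s ∈ Λ₁` acts on coordinates through a matrix
  `t ∈ Λ^{ι × ι}` (`Θ (s • m) i = ∑_j t i j • Θ m j`), then so does `s` on `H¹`:
  `coord (s • x) i = ∑_j t i j • coord x j` (the bridge to `Λ₁`-linearity downstream).
* `cohomologyCoord_map` — compatibility with Mathlib's functoriality `ContinuousCohomology.map θ f 1`
  along a continuous `θ : H → G` and compatible pairs `f : res θ X ⟶ Y`, `f₁ : res θ X₁ ⟶ Y₁`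
  intertwining two coordinate systems (restriction to decomposition / inertia groups downstream).

No topology beyond Mathlib's is put on `H¹`; nothing is asserted about higher `Hⁿ`.

References: [SerreGaloisCohomology1997] I §2.2 (inhomogeneous cochains; finite products),
I §5.1 (`H¹` as crossed homomorphisms modulo principal ones); used for [Skinner2016PacificMC] §2.3
(p. 179: `Sel(T ⊗_𝒪 𝒪₁) ≅ Sel(T) ⊗_𝒪 𝒪₁`).
-/

noncomputable section

open CategoryTheory

universe u

namespace Literature.NumberTheory.GaloisRepresentations

variable {Λ : Type*} [Ring Λ] [TopologicalSpace Λ] {Λ₁ : Type*} [Ring Λ₁] [TopologicalSpace Λ₁]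
variable {G : Type u} [Group G] [TopologicalSpace G]
variable {ι : Type u}
variable {X : TopRep.{u} Λ G} {X₁ : TopRep.{u} Λ₁ G}
variable (Θ : X₁ ≃+ (ι → X)) (hΘ : Continuous Θ) (hΘ' : Continuous Θ.symm)
  (hρ : ∀ (g : G) (m : X₁) (i : ι), Θ (X₁.ρ g m) i = X.ρ g (Θ m i))

/-! ### §1. Coordinates of crossed homomorphisms -/

section Cocycles

/-- **The `i`-th coordinate crossed homomorphism** `g ↦ Θ (φ g) i` of a continuous crossed
homomorphism `φ : G → X₁`, with respect to an equivariant coordinate system `Θ : X₁ ≃ X^ι`.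
[cite: SerreGaloisCohomology1997, I §2.2 (inhomogeneous cochains) and I §5.1 (crossed homomorphisms)] -/
def cocycleCoord (φ : contOneCocycles X₁) (i : ι) : contOneCocycles X :=
  ⟨⟨fun g ↦ Θ (φ.1 g) i, (continuous_apply i).comp (hΘ.comp φ.1.continuous)⟩, fun g h ↦ by
    change Θ (φ.1 (g * h)) i = Θ (φ.1 g) i + X.ρ g (Θ (φ.1 h) i)
    rw [φ.2 g h, map_add, Pi.add_apply, hρ]⟩

/-- Unfolding `cocycleCoord`. [cite: SerreGaloisCohomology1997, I §2.2] -/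
@[simp] theorem cocycleCoord_apply (φ : contOneCocycles X₁) (i : ι) (g : G) :
    (cocycleCoord Θ hΘ hρ φ i).1 g = Θ (φ.1 g) i := rfl

/-- `cocycleCoord` is additive in the cocycle. [cite: SerreGaloisCohomology1997, I §2.2] -/
theorem cocycleCoord_add (φ ψ : contOneCocycles X₁) (i : ι) :
    cocycleCoord Θ hΘ hρ (φ + ψ) i = cocycleCoord Θ hΘ hρ φ i + cocycleCoord Θ hΘ hρ ψ i := by
  refine Subtype.ext (ContinuousMap.ext fun g ↦ ?_)
  change Θ (φ.1 g + ψ.1 g) i = Θ (φ.1 g) i + Θ (ψ.1 g) i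
  rw [map_add, Pi.add_apply]

/-- `cocycleCoord` respects subtraction. [cite: SerreGaloisCohomology1997, I §2.2] -/
theorem cocycleCoord_sub (φ ψ : contOneCocycles X₁) (i : ι) :
    cocycleCoord Θ hΘ hρ (φ - ψ) i = cocycleCoord Θ hΘ hρ φ i - cocycleCoord Θ hΘ hρ ψ i := by
  refine Subtype.ext (ContinuousMap.ext fun g ↦ ?_)
  change Θ (φ.1 g - ψ.1 g) i = Θ (φ.1 g) i - Θ (ψ.1 g) i
  rw [map_sub, Pi.sub_apply]

/-- **Scalars acting through a matrix on coordinates act through the same matrix on coordinate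
cocycles**: if `Θ (s • m) i = ∑_j t i j • Θ m j` for all `m`, then
`coord (s • φ) i = ∑_j t i j • coord φ j`. [cite: SerreGaloisCohomology1997, I §2.2] -/
theorem cocycleCoord_smul_of_matrix [Fintype ι] (s : Λ₁) (t : ι → ι → Λ)
    (hst : ∀ (m : X₁) (i : ι), Θ (s • m) i = ∑ j, t i j • Θ m j) (φ : contOneCocycles X₁) (i : ι) :
    cocycleCoord Θ hΘ hρ (s • φ) i = ∑ j, t i j • cocycleCoord Θ hΘ hρ φ j := by
  refine Subtype.ext (ContinuousMap.ext fun g ↦ ?_)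
  change Θ (s • φ.1 g) i = _
  rw [hst, Submodule.coe_sum, ContinuousMap.coe_sum, Finset.sum_apply]
  rfl

omit [TopologicalSpace G] in
include hρ in
/-- The equivariance of `Θ⁻¹`: `Θ⁻¹ (g • v) = g • Θ⁻¹ v`. [cite: SerreGaloisCohomology1997, I §2.2] -/
theorem symm_smul_eq (g : G) (v : ι → X) :
    Θ.symm (fun i ↦ X.ρ g (v i)) = X₁.ρ g (Θ.symm v) := by
  apply Θ.injective
  rw [AddEquiv.apply_symm_apply]
  funext i
  rw [hρ, AddEquiv.apply_symm_apply]

/-- **Assembling a crossed homomorphism from coordinate crossed homomorphisms**: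
`g ↦ Θ⁻¹ ((ψ_i g)_i)`. [cite: SerreGaloisCohomology1997, I §2.2 (inhomogeneous cochains)] -/
def cocyclesOfCoords (ψ : ι → contOneCocycles X) : contOneCocycles X₁ :=
  ⟨⟨fun g ↦ Θ.symm (fun i ↦ (ψ i).1 g),
    hΘ'.comp (continuous_pi fun i ↦ (ψ i).1.continuous)⟩, fun g h ↦ by
    change Θ.symm (fun i ↦ (ψ i).1 (g * h)) =
      Θ.symm (fun i ↦ (ψ i).1 g) + X₁.ρ g (Θ.symm (fun i ↦ (ψ i).1 h))
    rw [← symm_smul_eq Θ hρ, ← map_add]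
    congr 1
    funext i
    rw [Pi.add_apply, (ψ i).2 g h]⟩

/-- Unfolding `cocyclesOfCoords`. [cite: SerreGaloisCohomology1997, I §2.2] -/
@[simp] theorem cocyclesOfCoords_apply (ψ : ι → contOneCocycles X) (g : G) :
    (cocyclesOfCoords Θ hΘ' hρ ψ).1 g = Θ.symm (fun i ↦ (ψ i).1 g) := rfl

/-- The coordinates of an assembled cocycle are the given ones. [cite: SerreGaloisCohomology1997, I §2.2] -/
theorem cocycleCoord_cocyclesOfCoords (ψ : ι → contOneCocycles X) (i : ι) :
    cocycleCoord Θ hΘ hρ (cocyclesOfCoords Θ hΘ' hρ ψ) i = ψ i := by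
  refine Subtype.ext (ContinuousMap.ext fun g ↦ ?_)
  change Θ (Θ.symm (fun i ↦ (ψ i).1 g)) i = (ψ i).1 g
  rw [AddEquiv.apply_symm_apply]

/-- A cocycle is assembled from its coordinates. [cite: SerreGaloisCohomology1997, I §2.2] -/
theorem cocyclesOfCoords_cocycleCoord (φ : contOneCocycles X₁) :
    cocyclesOfCoords Θ hΘ' hρ (fun i ↦ cocycleCoord Θ hΘ hρ φ i) = φ := by
  refine Subtype.ext (ContinuousMap.ext fun g ↦ ?_)
  change Θ.symm (fun i ↦ Θ (φ.1 g) i) = φ.1 g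
  exact Θ.symm_apply_apply (φ.1 g)

/-- **A crossed homomorphism is principal iff all its coordinates are principal**
(`φ g = g • v - v` with `v = Θ⁻¹ (v_i)_i`). [cite: SerreGaloisCohomology1997, I §5.1 (principal crossed homomorphisms)] -/
theorem isPrincipal_iff_forall_cocycleCoord (φ : contOneCocycles X₁) :
    (∃ v : X₁, ∀ g, φ.1 g = X₁.ρ g v - v) ↔
      ∀ i, ∃ v : X, ∀ g, (cocycleCoord Θ hΘ hρ φ i).1 g = X.ρ g v - v := by
  constructor
  · rintro ⟨v, hv⟩ i
    refine ⟨Θ v i, fun g ↦ ?_⟩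
    rw [cocycleCoord_apply, hv g, map_sub, Pi.sub_apply, hρ]
  · intro h
    choose v hv using h
    refine ⟨Θ.symm v, fun g ↦ Θ.injective ?_⟩
    rw [map_sub, Θ.apply_symm_apply]
    funext i
    rw [Pi.sub_apply, hρ, Θ.apply_symm_apply]
    exact hv i g

end Cocycles

/-! ### §2. Coordinates of cohomology classes -/

section Classes

variable [IsTopologicalGroup G]

/-- **The coordinates of a class `x ∈ H¹(G, X₁)`**: the classes in `H¹(G, X)` of the coordinate
crossed homomorphisms of (any) representative of `x` (well defined:
`cohomologyCoord_oneCocycleClass`). [cite: SerreGaloisCohomology1997, I §2.2 (cohomology of a finite product)] -/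
def cohomologyCoord (x : continuousCohomology 1 X₁) (i : ι) : continuousCohomology 1 X :=
  oneCocycleClass X
    (cocycleCoord Θ hΘ hρ (Function.surjInv (oneCocycleClass_surjective X₁) x) i)

/-- **Well-definedness / the formula on representatives**: `coord [φ] i = [coord φ i]`.
[cite: SerreGaloisCohomology1997, I §2.2 and I §5.1] -/
theorem cohomologyCoord_oneCocycleClass (φ : contOneCocycles X₁) (i : ι) :
    cohomologyCoord Θ hΘ hρ (oneCocycleClass X₁ φ) i =
      oneCocycleClass X (cocycleCoord Θ hΘ hρ φ i) := by
  unfold cohomologyCoord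
  set φ' := Function.surjInv (oneCocycleClass_surjective X₁) (oneCocycleClass X₁ φ) with hφ'
  have hcl : oneCocycleClass X₁ φ' = oneCocycleClass X₁ φ :=
    Function.surjInv_eq (oneCocycleClass_surjective X₁) _
  have h0 : oneCocycleClass X₁ (φ' - φ) = 0 := by rw [oneCocycleClass_sub, hcl, sub_self]
  obtain ⟨v, hv⟩ := (oneCocycleClass_eq_zero_iff X₁ _).mp h0
  obtain ⟨w, hw⟩ := (isPrincipal_iff_forall_cocycleCoord Θ hΘ hρ (φ' - φ)).mp ⟨v, hv⟩ i
  rw [← sub_eq_zero, ← oneCocycleClass_sub, ← cocycleCoord_sub, oneCocycleClass_eq_zero_iff]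
  exact ⟨w, hw⟩

/-- `cohomologyCoord` is additive. [cite: SerreGaloisCohomology1997, I §2.2] -/
theorem cohomologyCoord_add (x y : continuousCohomology 1 X₁) (i : ι) :
    cohomologyCoord Θ hΘ hρ (x + y) i = cohomologyCoord Θ hΘ hρ x i + cohomologyCoord Θ hΘ hρ y i := by
  obtain ⟨φ, rfl⟩ := oneCocycleClass_surjective X₁ x
  obtain ⟨ψ, rfl⟩ := oneCocycleClass_surjective X₁ y
  rw [← oneCocycleClass_add, cohomologyCoord_oneCocycleClass, cohomologyCoord_oneCocycleClass,
    cohomologyCoord_oneCocycleClass, cocycleCoord_add, oneCocycleClass_add]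

/-- `cohomologyCoord` as an additive monoid homomorphism `H¹(G, X₁) →+ (ι → H¹(G, X))`.
[cite: SerreGaloisCohomology1997, I §2.2] -/
def cohomologyCoordHom : continuousCohomology 1 X₁ →+ (ι → continuousCohomology 1 X) where
  toFun := cohomologyCoord Θ hΘ hρ
  map_zero' := by
    funext i
    have h := cohomologyCoord_add Θ hΘ hρ 0 0 i
    rw [add_zero] at h
    exact left_eq_add.mp h
  map_add' x y := funext fun i ↦ cohomologyCoord_add Θ hΘ hρ x y i

/-- Unfolding `cohomologyCoordHom`. [cite: SerreGaloisCohomology1997, I §2.2] -/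
@[simp] theorem cohomologyCoordHom_apply (x : continuousCohomology 1 X₁) :
    cohomologyCoordHom Θ hΘ hρ x = cohomologyCoord Θ hΘ hρ x := rfl

include hΘ' in
/-- **Injectivity**: a class with all coordinates zero is zero (principal criterion coordinatewise).
[cite: SerreGaloisCohomology1997, I §2.2 and I §5.1] -/
theorem cohomologyCoord_injective : Function.Injective (cohomologyCoord Θ hΘ hρ) := by
  have _ := hΘ'
  refine (injective_iff_map_eq_zero (cohomologyCoordHom Θ hΘ hρ)).mpr fun x hx ↦ ?_
  obtain ⟨φ, rfl⟩ := oneCocycleClass_surjective X₁ x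
  rw [oneCocycleClass_eq_zero_iff, isPrincipal_iff_forall_cocycleCoord Θ hΘ hρ]
  intro i
  rw [← oneCocycleClass_eq_zero_iff, ← cohomologyCoord_oneCocycleClass]
  exact congrFun hx i

include hΘ' in
/-- **Surjectivity**: every family of classes is the coordinate family of the class of the assembled
cocycle. [cite: SerreGaloisCohomology1997, I §2.2] -/
theorem cohomologyCoord_surjective : Function.Surjective (cohomologyCoord Θ hΘ hρ) := by
  intro y
  choose ψ hψ using fun i ↦ oneCocycleClass_surjective X (y i)
  refine ⟨oneCocycleClass X₁ (cocyclesOfCoords Θ hΘ' hρ ψ), funext fun i ↦ ?_⟩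
  rw [cohomologyCoord_oneCocycleClass, cocycleCoord_cocyclesOfCoords, hψ]

/-- **`H¹(G, X₁) ≃ H¹(G, X)^ι`** along an equivariant coordinate system `X₁ ≃ X^ι` (additivity of
continuous `H¹` in the coefficient module, across the two coefficient rings).
[cite: SerreGaloisCohomology1997, I §2.2 (cohomology of a finite product of G-modules)] -/
def cohomologyCoordEquiv : continuousCohomology 1 X₁ ≃+ (ι → continuousCohomology 1 X) :=
  AddEquiv.ofBijective (cohomologyCoordHom Θ hΘ hρ)
    ⟨cohomologyCoord_injective Θ hΘ hΘ' hρ, cohomologyCoord_surjective Θ hΘ hΘ' hρ⟩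

/-- Unfolding `cohomologyCoordEquiv`. [cite: SerreGaloisCohomology1997, I §2.2] -/
@[simp] theorem cohomologyCoordEquiv_apply (x : continuousCohomology 1 X₁) :
    cohomologyCoordEquiv Θ hΘ hΘ' hρ x = cohomologyCoord Θ hΘ hρ x := rfl

/-- **Matrix scalars pass to cohomology**: if `s ∈ Λ₁` acts on coordinates through the matrix
`t ∈ Λ^{ι×ι}`, then `coord (s • x) i = ∑_j t i j • coord x j` on `H¹`.
[cite: SerreGaloisCohomology1997, I §2.2] -/
theorem cohomologyCoord_smul_of_matrix [Fintype ι] (s : Λ₁) (t : ι → ι → Λ)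
    (hst : ∀ (m : X₁) (i : ι), Θ (s • m) i = ∑ j, t i j • Θ m j)
    (x : continuousCohomology 1 X₁) (i : ι) :
    cohomologyCoord Θ hΘ hρ (s • x) i = ∑ j, t i j • cohomologyCoord Θ hΘ hρ x j := by
  obtain ⟨φ, rfl⟩ := oneCocycleClass_surjective X₁ x
  rw [← oneCocycleClass_smul, cohomologyCoord_oneCocycleClass,
    cocycleCoord_smul_of_matrix Θ hΘ hρ s t hst, ← oneCocycleClassₗ_apply, map_sum]
  refine Finset.sum_congr rfl fun j _ ↦ ?_
  rw [map_smul, oneCocycleClassₗ_apply, cohomologyCoord_oneCocycleClass]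

end Classes

/-! ### §3. Compatibility with restriction along `θ : H → G` -/

section Map

variable [IsTopologicalGroup G] {H : Type u} [Group H] [TopologicalSpace H] [IsTopologicalGroup H]
variable {Y : TopRep.{u} Λ H} {Y₁ : TopRep.{u} Λ₁ H}
variable (Ξ : Y₁ ≃+ (ι → Y)) (hΞ : Continuous Ξ)
  (hσ : ∀ (h : H) (m : Y₁) (i : ι), Ξ (Y₁.ρ h m) i = Y.ρ h (Ξ m i))

/-- **Coordinates commute with functoriality**: for a continuous `θ : H → G` and compatible pairs
`f : res θ X ⟶ Y`, `f₁ : res θ X₁ ⟶ Y₁` intertwining the coordinate systems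
(`Ξ (f₁ m) i = f (Θ m i)`), `coord_Y (θ^* x) i = θ^* (coord_X x i)` for Mathlib's
`ContinuousCohomology.map θ · 1`. [cite: SerreGaloisCohomology1997, I §2.4 (compatible pairs) and I §2.2] -/
theorem cohomologyCoord_map (θ : H →ₜ* G) (f : TopRep.res (θ : H →* G) X ⟶ Y)
    (f₁ : TopRep.res (θ : H →* G) X₁ ⟶ Y₁)
    (hf : ∀ (m : X₁) (i : ι), Ξ (f₁.hom m) i = f.hom (Θ m i))
    (x : continuousCohomology 1 X₁) (i : ι) :
    cohomologyCoord Ξ hΞ hσ (ContinuousCohomology.map θ f₁ 1 x) i =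
      ContinuousCohomology.map θ f 1 (cohomologyCoord Θ hΘ hρ x i) := by
  obtain ⟨φ, rfl⟩ := oneCocycleClass_surjective X₁ x
  rw [map_oneCocycleClass, cohomologyCoord_oneCocycleClass, cohomologyCoord_oneCocycleClass,
    map_oneCocycleClass]
  refine congrArg _ (Subtype.ext (ContinuousMap.ext fun h ↦ ?_))
  change Ξ (f₁.hom (φ.1 (θ h))) i = f.hom (Θ (φ.1 (θ h)) i)
  exact hf _ _

include hΞ hσ in
/-- The same, in the form "`θ^* x` has all coordinates zero iff all `θ^* (coord x i)` vanish".
[cite: SerreGaloisCohomology1997, I §2.4 and I §2.2] -/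
theorem map_eq_zero_iff_forall_cohomologyCoord (hΞ' : Continuous Ξ.symm) (θ : H →ₜ* G)
    (f : TopRep.res (θ : H →* G) X ⟶ Y) (f₁ : TopRep.res (θ : H →* G) X₁ ⟶ Y₁)
    (hf : ∀ (m : X₁) (i : ι), Ξ (f₁.hom m) i = f.hom (Θ m i))
    (x : continuousCohomology 1 X₁) :
    ContinuousCohomology.map θ f₁ 1 x = 0 ↔
      ∀ i, ContinuousCohomology.map θ f 1 (cohomologyCoord Θ hΘ hρ x i) = 0 := by
  rw [← (cohomologyCoord_injective Ξ hΞ hΞ' hσ).eq_iff, funext_iff]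
  refine forall_congr' fun i ↦ ?_
  rw [cohomologyCoord_map Θ hΘ hρ Ξ hΞ hσ θ f f₁ hf,
    show cohomologyCoord Ξ hΞ hσ 0 i = 0 from congrFun (cohomologyCoordHom Ξ hΞ hσ).map_zero i]

end Map

end Literature.NumberTheory.GaloisRepresentations
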